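import Literature.Analysis.FluidPDE.CompressibleEulerDerivEnergyDataBound
import Literature.MathematicalPhysics.KineticTheory.HardSphereEuler

/-!
# The derivative energy of a slice with bounded derivatives (stub `stub_derivEnergyDataBound`)

Crux `Summit.AtomisticToContinuum.HydrodynamicLimit.Theses.ImplosionDichotomy.DiluteSelfConsistency`
(stmt-AtomisticToContinuum-3091; `Iff.rfl`-equal copy `Theses.ImplosionLoophole.DiluteSelfConsistency`),
line `birth` (rev c3), stub `stub_derivEnergyDataBound` — layer 4c of the fixed-horizon stability
estimate (layer 4 of Kato's continuous-dependence theorem, Kato 1975 Thm III) for the hard-sphere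
Euler family: the derivative-only level-`3` energy `D₃(t) = CompressibleEuler.derivLevelEnergy ρ u θ 3 t`
of a smooth slice `(ρ t, u t, θ t)` on `𝕋³` is at most `200 B²` when all its nested partial
derivatives of orders `1 ≤ |w| ≤ 3` are bounded by `B` pointwise (`39` nonempty words of length
`≤ 3`, each word energy `≤ B² + 3B² + B² = 5B²` on the unit-volume torus; `195 ≤ 200`).

Thin wrapper, with the registered stub name, of the Analysis/FluidPDE support theorem
`CompressibleEuler.derivLevelEnergy_three_le_of_pointwise`
(`Literature/Analysis/FluidPDE/CompressibleEulerDerivEnergyDataBound.lean`); `T3`, `V3` are the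
reducible abbreviations of `UnitAddTorus (Fin 3)`, `EuclideanSpace ℝ (Fin 3)` of
`HardSphereEuler.lean`.

prover-line-stmt-AtomisticToContinuum-3091-c3-0 (line `birth`, rev c3; stub-worker w-4c).
-/

noncomputable section

namespace Summit.AtomisticToContinuum.HydrodynamicLimit.Theorems

open MeasureTheory Literature.MathematicalPhysics.KineticTheory Literature.Analysis.FluidPDE Literature.Analysis.FunctionSpaces

/-- **Stub 4c (the derivative energy of a slice with bounded derivatives).** If all nested partial
derivatives of orders `1 ≤ |w| ≤ 3` of the smooth slices `ρ t, u t, θ t` are bounded by `B ≥ 0`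
pointwise, then `CompressibleEuler.derivLevelEnergy ρ u θ 3 t ≤ 200 B²` (`39` words, three fields,
unit volume). [folklore] -/
theorem stub_derivEnergyDataBound :
    ∀ (ρ θ : ℝ → T3 → ℝ) (u : ℝ → T3 → V3) (t B : ℝ), 0 ≤ B →
      Torus.IsSmooth (ρ t) → Torus.IsSmooth (θ t) → Torus.IsSmooth (u t) →
      (∀ w : List (Fin 3), 1 ≤ w.length → w.length ≤ 3 → ∀ x,
          |Torus.iterPartialDeriv w (ρ t) x| ≤ B ∧ ‖Torus.iterPartialDeriv w (u t) x‖ ≤ B ∧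
            |Torus.iterPartialDeriv w (θ t) x| ≤ B) →
      CompressibleEuler.derivLevelEnergy ρ u θ 3 t ≤ 200 * B ^ 2 :=
  CompressibleEuler.derivLevelEnergy_three_le_of_pointwise

end Summit.AtomisticToContinuum.HydrodynamicLimit.Theorems

end
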